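import Summits.HodgeConjecture.HodgeConjecture.Theorems.Q8BireflectionRecognition
import Literature.AlgebraicGeometry.HodgeTheory.CyclicReflectionVanishingNondegenerate
import HarnessLib

/-!
# Route `Q8SymplecticPowers`, crux K1Q — bireflection recognition from GLOBAL Poincaré duality only
# (the per-plane non-degeneracy of `Q|_{V_k}` in `exists_bireflection_datum_of_localMonodromy` is automatic)

Support file for crux K1Q (stmt-HodgeConjecture-24190; `--supports … --as helper`). Prover seat `hodge-nonav-prover-Ax` (g17).
Sequel of `Q8BireflectionRecognition`: the vanishing space `V₁ ⊔ V₂` of the d6 meridian `γ` carries no `γ`-fixed vector (`γ = A` on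
`V₁`, `γ = −A` on `V₂`, `A² = −1`), so by route A's `nondegenerate_on_of_isometry_of_sub_mem` (Carlson–Toledo §6: the vanishing space
of an isometry without fixed vanishing vector is non-degenerate) it is `Q`-non-degenerate as soon as `Q` is non-degenerate on `H`
(Poincaré duality), and `V₁ ⊥ V₂` splits this to the planes. Hence **`exists_bireflection_datum_of_localMonodromy'`**: the S5
currency from the local-monodromy shape WITHOUT any local intersection-form computation — the target MON-C's bricks L6-4∕L6-6
should aim at. HONEST FRAMING: linear algebra only; the geometric bricks are not touched; K1Q ∕ HC NOT proved.
-/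

noncomputable section

set_option linter.dupNamespace false

namespace Summit.HodgeConjecture.HodgeConjecture.Theorems.Q8BireflectionRecognition

open Module Literature.AlgebraicGeometry.HodgeTheory
open LinearMap (BilinForm)
open scoped TensorProduct

variable {K : Type*} [Field K] {L : Type*} [Field L] [CharZero L] [Algebra K L] {H : Type*} [AddCommGroup H] [Module K H]
  [FiniteDimensional K H]

/-- **BIREFLECTION RECOGNITION from global Poincaré duality.** As `exists_bireflection_datum_of_localMonodromy`, with the
hypotheses «`Q|_{V₁}`, `Q|_{V₂}` non-degenerate» replaced by «`Q` non-degenerate on `H`»: the isometry `γ` has no fixed vector in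
its vanishing space `V₁ ⊔ V₂`, which is therefore non-degenerate (`nondegenerate_on_of_isometry_of_sub_mem`), and `V₁ ⊥ V₂`. -/
theorem exists_bireflection_datum_of_localMonodromy' {Q : BilinForm K H} (hQs : ∀ x y, Q x y = Q y x) (hQn : Q.Nondegenerate)
    {A B : H →ₗ[K] H} (haQ : ∀ x y, Q (A x) (A y) = Q x y) (hQb : ∀ x y, Q (B x) (B y) = Q x y) {γ : H ≃ₗ[K] H}
    (hγA : ∀ x, γ (A x) = A (γ x)) (hγQ : ∀ x y, Q (γ x) (γ y) = Q x y) (V₁ V₂ W : Submodule K H) (hV₁W : V₁ ≤ W)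
    (hV₂W : V₂ ≤ W) (hdim₁ : finrank K V₁ = 2) (hdim₂ : finrank K V₂ = 2) (hAV₁ : ∀ x ∈ V₁, A x ∈ V₁)
    (hAV₂ : ∀ x ∈ V₂, A x ∈ V₂) (haa₁ : ∀ x ∈ V₁, A (A x) = -x) (haa₂ : ∀ x ∈ V₂, A (A x) = -x)
    (hBV₁ : ∀ x ∈ V₁, B x ∈ V₂) (hBV₂ : ∀ x ∈ V₂, B x ∈ V₁) (hbb₁ : ∀ x ∈ V₁, B (B x) = -x) (hbb₂ : ∀ x ∈ V₂, B (B x) = -x)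
    (hab₁ : ∀ x ∈ V₁, A (B x) = -B (A x)) (hab₂ : ∀ x ∈ V₂, A (B x) = -B (A x)) (horth : ∀ x ∈ V₁, ∀ y ∈ V₂, Q x y = 0)
    (hγV : ∀ x, γ x - x ∈ V₁ ⊔ V₂) (hγ₁ : ∀ x ∈ V₁, γ x = A x) (hγ₂ : ∀ x ∈ V₂, γ x = -A x) {i : L} (hi : i * i = -1) :
    ∃ ℓp ℓm : L ⊗[K] H, ℓp ∈ W.baseChange L ∧ ℓm ∈ W.baseChange L ∧ A.baseChange L ℓp = i • ℓp ∧ A.baseChange L ℓm = i • ℓm ∧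
      (Q.baseChange L) ℓp (B.baseChange L ℓm) ≠ 0 ∧ (γ.toLinearMap.baseChange L) ℓp = i • ℓp ∧
      (γ.toLinearMap.baseChange L) ℓm = (-i) • ℓm ∧
      ∀ x ∈ W.baseChange L, A.baseChange L x = i • x → (Q.baseChange L) x (B.baseChange L ℓp) = 0 →
        (Q.baseChange L) x (B.baseChange L ℓm) = 0 → (γ.toLinearMap.baseChange L) x = x := by
  -- `2 ≠ 0` in `K` (there is a field map `K → L`, `char L = 0`)
  have h2K : (2 : K) ≠ 0 := fun h => two_ne_zero (α := L) (by rw [← map_ofNat (algebraMap K L) 2, h, map_zero])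
  have hx2 : ∀ x : H, x = -x → x = 0 := fun x hx => by
    have h : (2 : K) • x = 0 := by rw [two_smul]; exact eq_neg_iff_add_eq_zero.1 hx
    exact (smul_eq_zero.1 h).resolve_left h2K
  -- no `A`-fixed ∕ `A`-anti-fixed vector on a plane where `A² = −1`
  have hfixA : ∀ {V : Submodule K H}, (∀ x ∈ V, A (A x) = -x) → ∀ x ∈ V, A x = x → x = 0 := by
    intro V haa x hx h
    exact hx2 x (calc x = A x := h.symm
      _ = A (A x) := by rw [h, h]
      _ = -x := haa x hx)
  have hantiA : ∀ {V : Submodule K H}, (∀ x ∈ V, A (A x) = -x) → ∀ x ∈ V, A x = -x → x = 0 := by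
    intro V haa x hx h
    have := haa x hx
    rw [h, map_neg, h, neg_neg] at this
    exact hx2 x this
  -- `V₁ ∩ V₂ = 0`: there `A z = γ z = −A z`
  have hcap : ∀ z ∈ V₁, z ∈ V₂ → z = 0 := fun z h₁ h₂ => by
    have hAz : A z = 0 := hx2 _ ((hγ₁ z h₁).symm.trans (hγ₂ z h₂))
    have := haa₁ z h₁
    rw [hAz, map_zero] at this
    exact neg_eq_zero.1 this.symm
  -- no `γ`-fixed vector in `V₁ ⊔ V₂`
  have hfix : ∀ w ∈ V₁ ⊔ V₂, γ w = w → w = 0 := by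
    intro w hw hγw
    obtain ⟨w₁, h₁, w₂, h₂, rfl⟩ := Submodule.mem_sup.1 hw
    rw [map_add, hγ₁ w₁ h₁, hγ₂ w₂ h₂] at hγw
    have e : A w₁ - w₁ = w₂ + A w₂ := by
      calc A w₁ - w₁ = (A w₁ + -A w₂) - w₁ + A w₂ := by abel
        _ = (w₁ + w₂) - w₁ + A w₂ := by rw [hγw]
        _ = w₂ + A w₂ := by abel
    have e0 : A w₁ - w₁ = 0 :=
      hcap _ (V₁.sub_mem (hAV₁ w₁ h₁) h₁) (by rw [e]; exact V₂.add_mem h₂ (hAV₂ w₂ h₂))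
    have hw₁ : w₁ = 0 := hfixA haa₁ w₁ h₁ (sub_eq_zero.1 e0)
    have e0' : w₂ + A w₂ = 0 := by rw [← e]; exact e0
    have hw₂ : w₂ = 0 := hantiA haa₂ w₂ h₂ (eq_neg_iff_add_eq_zero.2 (by rw [add_comm]; exact e0'))
    rw [hw₁, hw₂, add_zero]
  -- the vanishing space is non-degenerate, and so are the planes
  have hndW := nondegenerate_on_of_isometry_of_sub_mem Q hQn γ hγQ (V₁ ⊔ V₂) hγV hfix
  have hnd₁ : ∀ x ∈ V₁, (∀ y ∈ V₁, Q x y = 0) → x = 0 := fun x hx hxy =>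
    hndW x (Submodule.mem_sup_left hx) fun y hy => by
      obtain ⟨y₁, hy₁, y₂, hy₂, rfl⟩ := Submodule.mem_sup.1 hy
      rw [map_add, hxy y₁ hy₁, horth x hx y₂ hy₂, add_zero]
  have hnd₂ : ∀ x ∈ V₂, (∀ y ∈ V₂, Q x y = 0) → x = 0 := fun x hx hxy =>
    hndW x (Submodule.mem_sup_right hx) fun y hy => by
      obtain ⟨y₁, hy₁, y₂, hy₂, rfl⟩ := Submodule.mem_sup.1 hy
      rw [map_add, hxy y₂ hy₂, hQs, horth y₁ hy₁ x hx, zero_add]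
  exact exists_bireflection_datum_of_localMonodromy hQs haQ hQb hγA hγQ V₁ V₂ W hV₁W hV₂W hdim₁ hdim₂ hAV₁ hAV₂ haa₁ haa₂ hBV₁
    hBV₂ hbb₁ hbb₂ hab₁ hab₂ horth hnd₁ hnd₂ hγV hγ₁ hγ₂ hi

end Summit.HodgeConjecture.HodgeConjecture.Theorems.Q8BireflectionRecognition

end
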